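import Summits.QuantumFields.YangMills.Theorems.UnitScaleGibbsOneBondSchwingerDyson
import Summits.QuantumFields.YangMills.Theorems.ScalingWindowSplitCurvatureAmnesiaWilsonSchwingerDyson
import Literature.MathematicalPhysics.QuantumFieldTheory.Balaban1983to89.BlockAveragingExpMeanLogContinuous
import Literature.MathematicalPhysics.QuantumLattice.RepLieAlgebraUnitary
import Mathlib.Analysis.SpecialFunctions.Exponential
import Mathlib.Analysis.Matrix.Normed
import HarnessLib

/-!
# The one-bond Schwinger–Dyson identity for Bałaban's Gibbs measure, MATRIX MODEL: the Wilson action and every `C¹` cylinder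
# observable are differentiable along `U ↦ U[b ↦ k(t)·U_b]`, `ρ(k(t)) = exp(tX)`; the `SU(N)` instance

Companion of ✓∕⧗ `UnitScaleGibbsOneBondSchwingerDyson` (the abstract identity `∫ f′ dμ_β = β·∫ f·A′ dμ_β` for Bałaban's
`gibbsMeasure P β` on `GaugeField P 0 G`, seat `ym-ust-19936-w8` gen 9; crux of record `UnitScaleTilt.HistoryTailL`
stmt-QuantumFields-19936, cell `ym3-torus` = YM ladder rung R3, NOT Clay).  That identity asks, of the action `A = wilsonAction4` and of
the observable `f`, a measurable bounded derivative along the one-bond shift.  This file DISCHARGES those hypotheses in a MATRIX MODEL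
of the abstract gauge group — a monoid homomorphism `ρ : G →* M_N(ℂ)`, continuous on the compact second-countable group `G`, with
`reTr g = Re tr ρ(g) ∕ N` (Bałaban's `GaugeGroup.ofUnitaryRep`; for `SU(N) = Matrix.specialUnitaryGroup (Fin N) ℂ` with the tree's
instances this is `ρ = fundamentalRep`, by `rfl`) — along any multiplicative family `k` with `ρ(k(t)) = exp(tX)`:

* §1 matrix calculus of the shifted link factors (`d∕dt|₀ exp(tX) = X`, `Re tr`, `k(−t) = k(t)⁻¹` imported from
  ✓ `…WardDefect.SchwingerDyson`; direct slot `X·ρ(U_b)`, inverse slot `ρ(U_b⁻¹)·(−X)`) and the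
  four-term Leibniz rule for Bałaban's plaquette variable `ρ(U(∂p))` (`GaugeField.plaqHol`) — verbatim the pattern of
  ✓ `…CurvatureAmnesia.WardDefect.SchwingerDyson.hasDerivAt_rho_holonomy` on the torus type;
* §2 ★★ `exists_hasDerivAt_wilsonAction4_oneBond` — `A = wilsonAction4` IS differentiable along the shift at every `U`, with a derivative
  `A′` that is CONTINUOUS, hence measurable and bounded on the compact configuration space: exactly the `(A′, hA′m, hCA′, hA′)` rows of
  `integral_shiftDeriv_eq_gibbsMeasure`;
* §3 ★★★ `gibbsMeasure_schwingerDyson_oneBond` — the Schwinger–Dyson identity with the action rows discharged: for every measurable bounded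
  `f` with a measurable bounded shift-derivative `f′`, `∫ f′ dμ_β = β·∫ f·A′ dμ_β`; and ★★ `gibbsMeasure_schwingerDyson_oneBond_specialUnitary`
  — the `SU(N)` instance along `k(t) = exp(tX)`, `X` skew-Hermitian traceless (lit ✓ `mem_oneParamGenerators_specialUnitaryGroup`).

THEOREMS ONLY (0 `def`, 0 `sorry`); `--supports stmt-QuantumFields-19936 --as helper`; `G : Type`.  HONEST SCOPE: finite-`β` calculus; nothing
of (Q), K1, `MeanDeviationL`, `HistoryTailL`, R3, d = 4, a continuum limit or a mass gap is proved; the YM gap is NOT proved.  References: Creutz,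
Quarks, Gluons and Lattices (2022) Ch. 11 [Creutz2022]; Chatterjee, CMP 366 (2019) §8 [Chatterjee2019LargeN]; Hall (2015) Prop. 3.24 [Hall2015].
-/

noncomputable section
open MeasureTheory Filter Topology NormedSpace
open scoped Matrix.Norms.Frobenius
open Literature.MathematicalPhysics.QuantumFieldTheory.Balaban1983to89
open Literature.MathematicalPhysics.QuantumFieldTheory.Balaban1983to89.T4GenFunBounds (gibbsMeasure)
open Literature.MathematicalPhysics.QuantumLattice (fundamentalRep mem_oneParamGenerators_specialUnitaryGroup)
open Summit.QuantumFields.YangMills.Theorems.EquipartitionPinsProbe.TangentSteinFiniteBeta (exists_abs_le_of_continuous)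
open Summit.QuantumFields.YangMills.Theorems.UnitScaleGibbsOneBondSchwingerDyson
open Summit.QuantumFields.YangMills.Cruxes.CurvatureAmnesia.WardDefect.SchwingerDyson
  (hasDerivAt_exp_coe_smul hasDerivAt_reTrace oneParam_neg)

namespace Summit.QuantumFields.YangMills.Theorems.UnitScaleGibbsOneBondSchwingerDysonMatrix

/-! ## §1 Matrix calculus of the shifted link factors and the Leibniz rule on Bałaban's plaquette variable -/

section MatrixCalculus

variable {N : ℕ}

variable {P : Params} {j : ℕ} [DecidableEq (PBond P j)] {G : Type} [GaugeGroup G]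
  (ρ : G →* Matrix (Fin N) (Fin N) ℂ) {k : ℝ → G} {X : Matrix (Fin N) (Fin N) ℂ}

/-- A direct link factor `ρ(U[b ↦ k(t)U_b]_{b'})`: derivative `X·ρ(U_b)` if `b' = b`, else `0`. [cite: Creutz2022, Ch. 11] -/
theorem hasDerivAt_factor (hX : ∀ t, ρ (k t) = exp ((t : ℂ) • X)) (b b' : PBond P j) (U : GaugeField P j G) :
    HasDerivAt (fun t : ℝ => ρ (Function.update U b (k t * U b) b'))
      (if b' = b then X * ρ (U b) else 0) 0 := by
  by_cases h : b' = b
  · subst h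
    simp only [Function.update_self, if_true, map_mul, hX]
    exact (hasDerivAt_exp_coe_smul X).mul_const _
  · simp only [Function.update_of_ne h, h, if_false]
    exact hasDerivAt_const _ _

/-- An inverse link factor `ρ((U[b ↦ k(t)U_b]_{b'})⁻¹)`: derivative `ρ(U_b⁻¹)·(−X)` if `b' = b`, else `0`. [cite: Creutz2022, Ch. 11] -/
theorem hasDerivAt_factor_inv (hk : ∀ s t, k (s + t) = k s * k t) (hX : ∀ t, ρ (k t) = exp ((t : ℂ) • X))
    (b b' : PBond P j) (U : GaugeField P j G) :
    HasDerivAt (fun t : ℝ => ρ ((Function.update U b (k t * U b) b')⁻¹))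
      (if b' = b then ρ ((U b)⁻¹) * (-X) else 0) 0 := by
  by_cases h : b' = b
  · subst h
    have hfun : (fun t : ℝ => ρ ((Function.update U b' (k t * U b') b')⁻¹)) =
        fun t : ℝ => ρ ((U b')⁻¹) * exp ((t : ℂ) • (-X)) := by
      funext t
      rw [Function.update_self, mul_inv_rev, ← oneParam_neg hk, map_mul, hX]
      congr 2
      push_cast
      rw [neg_smul, smul_neg]
    rw [hfun]
    simp only [if_true]
    exact (hasDerivAt_exp_coe_smul (-X)).const_mul _
  · simp only [Function.update_of_ne h, h, if_false]
    exact hasDerivAt_const _ _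

/-- **Leibniz rule on Bałaban's plaquette variable** `ρ(U(∂p))`, `U(∂p) = U_{b₁}U_{b₂}U_{b₃}⁻¹U_{b₄}⁻¹` (`GaugeField.plaqHol`), along the
one-bond shift: differentiable at `t = 0` with the four-term Leibniz sum as derivative. [cite: Creutz2022, Ch. 11] -/
theorem hasDerivAt_rho_plaqHol (hk : ∀ s t, k (s + t) = k s * k t) (hX : ∀ t, ρ (k t) = exp ((t : ℂ) • X))
    (b : PBond P j) (U : GaugeField P j G) (p : Plaq P j) :
    HasDerivAt (fun t : ℝ => ρ (GaugeField.plaqHol (Function.update U b (k t * U b)) p))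
      ((((if (⟨p.src, p.μ⟩ : PBond P j) = b then X * ρ (U b) else 0) * ρ (U ⟨p.src.shift p.μ, p.ν⟩) +
            ρ (U ⟨p.src, p.μ⟩) * (if (⟨p.src.shift p.μ, p.ν⟩ : PBond P j) = b then X * ρ (U b) else 0)) *
              ρ ((U ⟨p.src.shift p.ν, p.μ⟩)⁻¹) +
          ρ (U ⟨p.src, p.μ⟩) * ρ (U ⟨p.src.shift p.μ, p.ν⟩) *
            (if (⟨p.src.shift p.ν, p.μ⟩ : PBond P j) = b then ρ ((U b)⁻¹) * (-X) else 0)) * ρ ((U ⟨p.src, p.ν⟩)⁻¹) +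
        ρ (U ⟨p.src, p.μ⟩) * ρ (U ⟨p.src.shift p.μ, p.ν⟩) * ρ ((U ⟨p.src.shift p.ν, p.μ⟩)⁻¹) *
          (if (⟨p.src, p.ν⟩ : PBond P j) = b then ρ ((U b)⁻¹) * (-X) else 0)) 0 := by
  have h1 := hasDerivAt_factor ρ hX b ⟨p.src, p.μ⟩ U
  have h2 := hasDerivAt_factor ρ hX b ⟨p.src.shift p.μ, p.ν⟩ U
  have h3 := hasDerivAt_factor_inv ρ hk hX b ⟨p.src.shift p.ν, p.μ⟩ U
  have h4 := hasDerivAt_factor_inv ρ hk hX b ⟨p.src, p.ν⟩ U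
  have h := ((h1.mul h2).mul h3).mul h4
  have hz : ∀ b' : PBond P j, Function.update U b (k 0 * U b) b' = U b' := fun b' => by
    rw [update_mul_zero hk b U]
  simp only [Pi.mul_apply, hz] at h
  have hfun : ∀ t : ℝ, ρ (GaugeField.plaqHol (Function.update U b (k t * U b)) p) =
      ((((fun t : ℝ => ρ (Function.update U b (k t * U b) ⟨p.src, p.μ⟩)) * fun t : ℝ =>
          ρ (Function.update U b (k t * U b) ⟨p.src.shift p.μ, p.ν⟩)) *
        fun t : ℝ => ρ (Function.update U b (k t * U b) ⟨p.src.shift p.ν, p.μ⟩)⁻¹) *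
      fun t : ℝ => ρ (Function.update U b (k t * U b) ⟨p.src, p.ν⟩)⁻¹) t := by
    intro t
    simp only [Pi.mul_apply, GaugeField.plaqHol, map_mul]
  exact h.congr_of_eventuallyEq (Eventually.of_forall hfun)

variable [TopologicalSpace G] [IsTopologicalGroup G]

omit [DecidableEq (PBond P j)] [IsTopologicalGroup G] in
/-- Continuity in `U` of a direct-slot derivative factor. [cite: Creutz2022, Ch. 11] -/
theorem continuous_slotDeriv (hρ : Continuous ρ) (c : Prop) [Decidable c] (b : PBond P j) (Y : Matrix (Fin N) (Fin N) ℂ) :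
    Continuous fun U : GaugeField P j G => (if c then Y * ρ (U b) else 0 : Matrix (Fin N) (Fin N) ℂ) := by
  split_ifs
  · exact continuous_const.mul (hρ.comp (continuous_apply b))
  · exact continuous_const

omit [DecidableEq (PBond P j)] in
/-- Continuity in `U` of an inverse-slot derivative factor. [cite: Creutz2022, Ch. 11] -/
theorem continuous_slotDeriv_inv (hρ : Continuous ρ) (c : Prop) [Decidable c] (b : PBond P j) (Y : Matrix (Fin N) (Fin N) ℂ) :
    Continuous fun U : GaugeField P j G => (if c then ρ ((U b)⁻¹) * Y else 0 : Matrix (Fin N) (Fin N) ℂ) := by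
  split_ifs
  · exact (hρ.comp ((continuous_apply b).inv)).mul continuous_const
  · exact continuous_const

/-- Continuity in `U` of the Leibniz sum of one plaquette variable. [cite: Creutz2022, Ch. 11] -/
theorem continuous_leibniz (hρ : Continuous ρ) (b : PBond P j) (p : Plaq P j) :
    Continuous fun U : GaugeField P j G =>
      (((if (⟨p.src, p.μ⟩ : PBond P j) = b then X * ρ (U b) else 0) * ρ (U ⟨p.src.shift p.μ, p.ν⟩) +
            ρ (U ⟨p.src, p.μ⟩) * (if (⟨p.src.shift p.μ, p.ν⟩ : PBond P j) = b then X * ρ (U b) else 0)) *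
              ρ ((U ⟨p.src.shift p.ν, p.μ⟩)⁻¹) +
          ρ (U ⟨p.src, p.μ⟩) * ρ (U ⟨p.src.shift p.μ, p.ν⟩) *
            (if (⟨p.src.shift p.ν, p.μ⟩ : PBond P j) = b then ρ ((U b)⁻¹) * (-X) else 0)) * ρ ((U ⟨p.src, p.ν⟩)⁻¹) +
        ρ (U ⟨p.src, p.μ⟩) * ρ (U ⟨p.src.shift p.μ, p.ν⟩) * ρ ((U ⟨p.src.shift p.ν, p.μ⟩)⁻¹) *
          (if (⟨p.src, p.ν⟩ : PBond P j) = b then ρ ((U b)⁻¹) * (-X) else 0) := by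
  have hd : ∀ b' : PBond P j, Continuous fun U : GaugeField P j G => ρ (U b') :=
    fun b' => hρ.comp (continuous_apply b')
  have hi : ∀ b' : PBond P j, Continuous fun U : GaugeField P j G => ρ ((U b')⁻¹) :=
    fun b' => hρ.comp ((continuous_apply b').inv)
  have s1 := continuous_slotDeriv ρ hρ ((⟨p.src, p.μ⟩ : PBond P j) = b) b X
  have s2 := continuous_slotDeriv ρ hρ ((⟨p.src.shift p.μ, p.ν⟩ : PBond P j) = b) b X
  have s3 := continuous_slotDeriv_inv ρ hρ ((⟨p.src.shift p.ν, p.μ⟩ : PBond P j) = b) b (-X)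
  have s4 := continuous_slotDeriv_inv ρ hρ ((⟨p.src, p.ν⟩ : PBond P j) = b) b (-X)
  exact ((((s1.mul (hd _)).add ((hd _).mul s2)).mul (hi _)).add (((hd _).mul (hd _)).mul s3)).mul (hi _)
    |>.add ((((hd _).mul (hd _)).mul (hi _)).mul s4)

end MatrixCalculus

/-! ## §2 The Wilson action along the one-bond shift -/

section Action

variable {N : ℕ} {P : Params} {j : ℕ} [DecidableEq (PBond P j)] {G : Type} [GaugeGroup G]
  [TopologicalSpace G] [IsTopologicalGroup G] [CompactSpace G] [MeasurableSpace G] [BorelSpace G]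
  [SecondCountableTopology G]
  (ρ : G →* Matrix (Fin N) (Fin N) ℂ) {k : ℝ → G} {X : Matrix (Fin N) (Fin N) ℂ}

/-- ★★ **THE WILSON ACTION IS DIFFERENTIABLE ALONG THE ONE-BOND SHIFT, WITH A CONTINUOUS — HENCE MEASURABLE AND BOUNDED — DERIVATIVE**
(matrix model `reTr g = Re tr ρ(g) ∕ N`, compact second-countable `G`, continuous `ρ`, `ρ(k(t)) = exp(tX)`): `A′(U)` is the sum over
plaquettes of `−Re tr(Leibniz sum) ∕ N`.  These are exactly the action rows of ⧗`…UnitScaleGibbsOneBondSchwingerDyson.integral_shiftDeriv_eq_gibbsMeasure`.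
[cite: Creutz2022, Ch. 11; Chatterjee2019LargeN, §8] -/
theorem exists_hasDerivAt_wilsonAction4_oneBond (hρ : Continuous ρ) (hre : ∀ g : G, reTr g = (ρ g).trace.re / N)
    (hk : ∀ s t, k (s + t) = k s * k t) (hX : ∀ t, ρ (k t) = exp ((t : ℂ) • X)) (b : PBond P j) :
    ∃ A' : GaugeField P j G → ℝ, Continuous A' ∧ Measurable A' ∧ (∃ C : ℝ, ∀ U, |A' U| ≤ C) ∧
      ∀ U : GaugeField P j G,
        HasDerivAt (fun t : ℝ => wilsonAction4 (Function.update U b (k t * U b))) (A' U) 0 := by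
  set A' : GaugeField P j G → ℝ := fun U => ∑ p : Plaq P j,
      -((((if (⟨p.src, p.μ⟩ : PBond P j) = b then X * ρ (U b) else 0) * ρ (U ⟨p.src.shift p.μ, p.ν⟩) +
            ρ (U ⟨p.src, p.μ⟩) * (if (⟨p.src.shift p.μ, p.ν⟩ : PBond P j) = b then X * ρ (U b) else 0)) *
              ρ ((U ⟨p.src.shift p.ν, p.μ⟩)⁻¹) +
          ρ (U ⟨p.src, p.μ⟩) * ρ (U ⟨p.src.shift p.μ, p.ν⟩) *
            (if (⟨p.src.shift p.ν, p.μ⟩ : PBond P j) = b then ρ ((U b)⁻¹) * (-X) else 0)) * ρ ((U ⟨p.src, p.ν⟩)⁻¹) +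
        ρ (U ⟨p.src, p.μ⟩) * ρ (U ⟨p.src.shift p.μ, p.ν⟩) * ρ ((U ⟨p.src.shift p.ν, p.μ⟩)⁻¹) *
          (if (⟨p.src, p.ν⟩ : PBond P j) = b then ρ ((U b)⁻¹) * (-X) else 0)).trace.re / N with hA'
  have hc : Continuous A' := by
    refine continuous_finsetSum _ fun p _ => ?_
    exact ((Complex.continuous_re.comp (continuous_leibniz ρ hρ b p).matrix_trace).neg).div_const _
  haveI : CompactSpace (GaugeField P j G) := inferInstanceAs (CompactSpace (PBond P j → G))
  haveI : OpensMeasurableSpace (GaugeField P j G) := inferInstanceAs (OpensMeasurableSpace (PBond P j → G))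
  obtain ⟨C, -, hC⟩ := exists_abs_le_of_continuous hc
  refine ⟨A', hc, hc.measurable, ⟨C, hC⟩, fun U => ?_⟩
  have hfun : (fun t : ℝ => wilsonAction4 (Function.update U b (k t * U b))) = fun t : ℝ =>
      ∑ p : Plaq P j, (1 : ℝ) * (1 - (ρ (GaugeField.plaqHol (Function.update U b (k t * U b)) p)).trace.re / N) := by
    funext t
    unfold wilsonAction4 wilsonAction
    simp only [hre]
  rw [hfun]
  refine HasDerivAt.fun_sum fun p _ => ?_
  have h := ((hasDerivAt_reTrace (hasDerivAt_rho_plaqHol ρ hk hX b U p)).div_const (N : ℝ)).const_sub (1 : ℝ)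
  have h1 := h.const_mul (1 : ℝ)
  refine h1.congr_deriv ?_
  ring

omit [IsTopologicalGroup G] in
/-- ★ **`C¹` CYLINDER OBSERVABLES ARE ADMISSIBLE**: if `f(U) = g(b' ↦ ρ(U_{b'}))` with `g : (PBond → M_N(ℂ)) → ℝ` continuously differentiable,
then `f` is measurable and bounded and differentiable along the one-bond shift with the continuous (hence measurable, bounded) derivative
`f′(U) = Dg(ρ∘U)[b ↦ X·ρ(U_b), b' ≠ b ↦ 0]` — the observable rows of the Schwinger–Dyson identity. [cite: Chatterjee2019LargeN, §8] -/
theorem cylinder_rows (hρ : Continuous ρ) (hX : ∀ t, ρ (k t) = exp ((t : ℂ) • X)) (b : PBond P j)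
    {g : (PBond P j → Matrix (Fin N) (Fin N) ℂ) → ℝ} (hg : ContDiff ℝ 1 g) :
    ∃ f' : GaugeField P j G → ℝ, Continuous f' ∧ Measurable f' ∧ (∃ C : ℝ, ∀ U, |f' U| ≤ C) ∧
      Measurable (fun U : GaugeField P j G => g (fun b' => ρ (U b'))) ∧
      (∃ C : ℝ, ∀ U : GaugeField P j G, |g (fun b' => ρ (U b'))| ≤ C) ∧
      ∀ U : GaugeField P j G,
        HasDerivAt (fun t : ℝ => g (fun b' => ρ (Function.update U b (k t * U b) b'))) (f' U) 0 := by
  have hι : Continuous fun U : GaugeField P j G => (fun b' => ρ (U b') : PBond P j → Matrix (Fin N) (Fin N) ℂ) :=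
    continuous_pi fun b' => hρ.comp (continuous_apply b')
  set f' : GaugeField P j G → ℝ := fun U =>
    fderiv ℝ g (fun b' => ρ (U b')) (Pi.single b (X * ρ (U b))) with hf'
  have hgc : Continuous (fderiv ℝ g) := hg.continuous_fderiv one_ne_zero
  have hc : Continuous f' := by
    have hv : Continuous fun U : GaugeField P j G => (Pi.single b (X * ρ (U b)) : PBond P j → Matrix (Fin N) (Fin N) ℂ) := by
      refine continuous_pi fun b' => ?_
      by_cases hb : b' = b
      · subst hb
        simp only [Pi.single_eq_same]
        exact continuous_const.mul (hρ.comp (continuous_apply b'))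
      · simp only [Pi.single_eq_of_ne hb]
        exact continuous_const
    exact (hgc.comp hι).clm_apply hv
  haveI : CompactSpace (GaugeField P j G) := inferInstanceAs (CompactSpace (PBond P j → G))
  haveI : OpensMeasurableSpace (GaugeField P j G) := inferInstanceAs (OpensMeasurableSpace (PBond P j → G))
  obtain ⟨C, -, hC⟩ := exists_abs_le_of_continuous hc
  have hfc : Continuous fun U : GaugeField P j G => g (fun b' => ρ (U b')) := hg.continuous.comp hι
  obtain ⟨Cf, -, hCf⟩ := exists_abs_le_of_continuous hfc
  refine ⟨f', hc, hc.measurable, ⟨C, hC⟩, hfc.measurable, ⟨Cf, hCf⟩, fun U => ?_⟩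
  -- the curve `t ↦ (b' ↦ ρ(U[b ↦ k t U_b]_{b'}))` has derivative `Pi.single b (X ρ(U_b))` at `0`
  have hcurve : HasDerivAt (fun t : ℝ => (fun b' => ρ (Function.update U b (k t * U b) b') :
      PBond P j → Matrix (Fin N) (Fin N) ℂ)) (Pi.single b (X * ρ (U b))) 0 := by
    refine hasDerivAt_pi.2 fun b' => ?_
    have h := hasDerivAt_factor (P := P) (j := j) ρ hX b b' U
    by_cases hb : b' = b
    · subst hb
      rw [Pi.single_eq_same]; rw [if_pos rfl] at h
      exact h
    · rw [Pi.single_eq_of_ne hb]; rw [if_neg hb] at h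
      exact h
  have h0 : (fun b' => ρ (Function.update U b (k 0 * U b) b')) = fun b' => ρ (U b') := by
    funext b'
    have hk0 : ρ (k 0) = 1 := by
      have := hX 0
      simpa using this
    by_cases hb : b' = b
    · subst hb; simp [hk0]
    · simp [Function.update_of_ne hb]
  have hgd : HasFDerivAt g (fderiv ℝ g (fun b' => ρ (U b'))) (fun b' => ρ (Function.update U b (k 0 * U b) b')) := by
    rw [h0]; exact (hg.differentiable one_ne_zero _).hasFDerivAt
  exact hgd.comp_hasDerivAt (0 : ℝ) hcurve

end Action

/-! ## §3 The Schwinger–Dyson identity with the action rows discharged; the `SU(N)` instance -/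

section SchwingerDyson

variable {N : ℕ} {P : Params} [DecidableEq (PBond P 0)] {G : Type} [GaugeGroup G]
  [TopologicalSpace G] [IsTopologicalGroup G] [CompactSpace G] [MeasurableSpace G] [BorelSpace G]
  [SecondCountableTopology G] [RegularGaugeGroup G] [HaarData G]
  (ρ : G →* Matrix (Fin N) (Fin N) ℂ) {k : ℝ → G} {X : Matrix (Fin N) (Fin N) ℂ}

/-- ★★★ **ONE-BOND SCHWINGER–DYSON IDENTITY, MATRIX MODEL** (`β ≥ 0`; compact second-countable `G` with a continuous matrix model
`reTr = Re tr ρ ∕ N`; `ρ(k(t)) = exp(tX)`): for every measurable bounded observable `f` with a measurable bounded shift-derivative `f′`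
there is the (continuous) action derivative `A′` of §2 with `∫ f′ dμ_β = β·∫ f·A′ dμ_β`. [cite: Chatterjee2019LargeN, §8; Creutz2022, Ch. 11] -/
theorem gibbsMeasure_schwingerDyson_oneBond (hρ : Continuous ρ) (hre : ∀ g : G, reTr g = (ρ g).trace.re / N)
    {β : ℝ} (hβ : 0 ≤ β) (b : PBond P 0) (hk : ∀ s t, k (s + t) = k s * k t) (hX : ∀ t, ρ (k t) = exp ((t : ℂ) • X))
    (f f' : GaugeField P 0 G → ℝ) (hfm : Measurable f) (hf'm : Measurable f') {Cf Cf' : ℝ}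
    (hCf : ∀ U, |f U| ≤ Cf) (hCf' : ∀ U, |f' U| ≤ Cf')
    (hf' : ∀ U, HasDerivAt (fun t => f (Function.update U b (k t * U b))) (f' U) 0) :
    ∃ A' : GaugeField P 0 G → ℝ, Continuous A' ∧
      (∀ U, HasDerivAt (fun t : ℝ => wilsonAction4 (Function.update U b (k t * U b))) (A' U) 0) ∧
      ∫ U, f' U ∂gibbsMeasure P β = β * ∫ U, f U * A' U ∂gibbsMeasure P β := by
  obtain ⟨A', hA'c, hA'm, ⟨CA', hCA'⟩, hA'⟩ := exists_hasDerivAt_wilsonAction4_oneBond (P := P) (j := 0) ρ hρ hre hk hX b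
  exact ⟨A', hA'c, hA', integral_shiftDeriv_eq_gibbsMeasure hβ b hk f f' hfm hf'm hCf hCf' hf' A' hA'm hCA' hA'⟩

/-- ★★ **`C¹` CYLINDER FORM**: for `f = g ∘ (ρ∘·)` with `g` continuously differentiable on `(PBond → M_N(ℂ))`, both `f′` and `A′` are supplied:
`∫ Dg(ρ∘U)[δ_b X·ρ(U_b)] dμ_β(U) = β·∫ g(ρ∘U)·A′(U) dμ_β(U)`. [cite: Chatterjee2019LargeN, §8] -/
theorem gibbsMeasure_schwingerDyson_oneBond_cylinder (hρ : Continuous ρ) (hre : ∀ g : G, reTr g = (ρ g).trace.re / N)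
    {β : ℝ} (hβ : 0 ≤ β) (b : PBond P 0) (hk : ∀ s t, k (s + t) = k s * k t) (hX : ∀ t, ρ (k t) = exp ((t : ℂ) • X))
    {g : (PBond P 0 → Matrix (Fin N) (Fin N) ℂ) → ℝ} (hg : ContDiff ℝ 1 g) :
    ∃ A' : GaugeField P 0 G → ℝ, Continuous A' ∧
      (∀ U, HasDerivAt (fun t : ℝ => wilsonAction4 (Function.update U b (k t * U b))) (A' U) 0) ∧
      ∫ U, fderiv ℝ g (fun b' => ρ (U b')) (Pi.single b (X * ρ (U b))) ∂gibbsMeasure P β =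
        β * ∫ U, g (fun b' => ρ (U b')) * A' U ∂gibbsMeasure P β := by
  obtain ⟨f', hc, hm, ⟨C, hC⟩, hfm, ⟨Cf, hCf⟩, hf'⟩ := cylinder_rows (P := P) (j := 0) ρ hρ hX b hg
  obtain ⟨A', hA'c, hA', hSD⟩ := gibbsMeasure_schwingerDyson_oneBond ρ hρ hre hβ b hk hX
    (fun U => g (fun b' => ρ (U b'))) f' hfm hm hCf hC hf'
  refine ⟨A', hA'c, hA', ?_⟩
  -- identify `f'` with the displayed Fréchet-derivative expression (both are the derivative of the same curve at `0`)
  have hf'eq : ∀ U : GaugeField P 0 G, f' U = fderiv ℝ g (fun b' => ρ (U b')) (Pi.single b (X * ρ (U b))) := by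
    intro U
    obtain ⟨f'', -, -, -, -, -, hf''⟩ := cylinder_rows (P := P) (j := 0) ρ hρ hX b hg
    -- recompute: the curve derivative is unique
    have hcurve : HasDerivAt (fun t : ℝ => (fun b' => ρ (Function.update U b (k t * U b) b') :
        PBond P 0 → Matrix (Fin N) (Fin N) ℂ)) (Pi.single b (X * ρ (U b))) 0 := by
      refine hasDerivAt_pi.2 fun b' => ?_
      have h := hasDerivAt_factor (P := P) (j := 0) ρ hX b b' U
      by_cases hb : b' = b
      · subst hb
        rw [Pi.single_eq_same]; rw [if_pos rfl] at h
        exact h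
      · rw [Pi.single_eq_of_ne hb]; rw [if_neg hb] at h
        exact h
    have h0 : (fun b' => ρ (Function.update U b (k 0 * U b) b')) = fun b' => ρ (U b') := by
      funext b'
      have hk0 : ρ (k 0) = 1 := by simpa using hX 0
      by_cases hb : b' = b
      · subst hb; simp [hk0]
      · simp [Function.update_of_ne hb]
    have hgd : HasFDerivAt g (fderiv ℝ g (fun b' => ρ (U b'))) (fun b' => ρ (Function.update U b (k 0 * U b) b')) := by
      rw [h0]; exact (hg.differentiable one_ne_zero _).hasFDerivAt
    exact (hf' U).unique (hgd.comp_hasDerivAt (0 : ℝ) hcurve)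
  have : (fun U : GaugeField P 0 G => f' U) = fun U => fderiv ℝ g (fun b' => ρ (U b')) (Pi.single b (X * ρ (U b))) :=
    funext hf'eq
  rw [← this]
  exact hSD

end SchwingerDyson

/-! ## §4 The `SU(N)` instance along `exp(t·X)`, `X ∈ 𝔰𝔲(N)` -/

section SpecialUnitary

variable {N : ℕ}

/-- A traceless skew-Hermitian `X` generates a multiplicative family `k(t) = exp(tX)` IN `SU(N)` (lit ✓ `mem_oneParamGenerators_specialUnitaryGroup`,
Hall Prop. 3.24), with `fundamentalRep (k t) = exp(tX)`. [cite: Hall2015, Proposition 3.24] -/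
theorem exists_oneParam_specialUnitaryGroup {X : Matrix (Fin N) (Fin N) ℂ} (hXs : star X = -X) (hX0 : X.trace = 0) :
    ∃ k : ℝ → Matrix.specialUnitaryGroup (Fin N) ℂ, (∀ s t, k (s + t) = k s * k t) ∧
      ∀ t : ℝ, fundamentalRep (Fin N) (k t) = exp ((t : ℂ) • X) := by
  have hmem := mem_oneParamGenerators_specialUnitaryGroup (n := Fin N) (X := X) hXs hX0
  refine ⟨fun t => ⟨exp (t • X), hmem t⟩, fun s t => Subtype.ext ?_, fun t => ?_⟩
  · change exp ((s + t) • X) = exp (s • X) * exp (t • X)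
    rw [add_smul]
    exact Matrix.exp_add_of_commute _ _ (((Commute.refl X).smul_left s).smul_right t)
  · change exp (t • X) = exp ((t : ℂ) • X)
    rw [Complex.coe_smul]

variable [NeZero N] {P : Params} [DecidableEq (PBond P 0)]

/-- ★★ **THE ONE-BOND SCHWINGER–DYSON IDENTITY FOR `SU(N)` LATTICE GAUGE FIELDS ON BAŁABAN'S FINEST TORUS** along `exp(tX)`, `X ∈ 𝔰𝔲(N)`
(the tree's instances `instGaugeGroupSpecialUnitaryGroup` ∕ `instRegularGaugeGroupSpecialUnitaryGroup` ∕ `instHaarDataSpecialUnitaryGroup`, for which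
`reTr U = Re tr U ∕ N` by `rfl`): for every measurable bounded `f` with a measurable bounded shift-derivative `f′`,
`∫ f′ dμ_β = β·∫ f·A′ dμ_β` with `A′` the continuous shift-derivative of the Wilson action; in particular for `gibbsK F ℰ γ K`
(`= gibbsMeasure (F.P K) β_K` by `rfl`). [cite: Chatterjee2019LargeN, §8; Creutz2022, Ch. 11] -/
theorem gibbsMeasure_schwingerDyson_oneBond_specialUnitary {β : ℝ} (hβ : 0 ≤ β) (b : PBond P 0)
    {X : Matrix (Fin N) (Fin N) ℂ} {k : ℝ → Matrix.specialUnitaryGroup (Fin N) ℂ} (hk : ∀ s t, k (s + t) = k s * k t)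
    (hkX : ∀ t : ℝ, fundamentalRep (Fin N) (k t) = exp ((t : ℂ) • X))
    (f f' : GaugeField P 0 (Matrix.specialUnitaryGroup (Fin N) ℂ) → ℝ) (hfm : Measurable f) (hf'm : Measurable f')
    {Cf Cf' : ℝ} (hCf : ∀ U, |f U| ≤ Cf) (hCf' : ∀ U, |f' U| ≤ Cf')
    (hf' : ∀ U, HasDerivAt (fun t => f (Function.update U b (k t * U b))) (f' U) 0) :
    ∃ A' : GaugeField P 0 (Matrix.specialUnitaryGroup (Fin N) ℂ) → ℝ, Continuous A' ∧
      (∀ U, HasDerivAt (fun t : ℝ => wilsonAction4 (Function.update U b (k t * U b))) (A' U) 0) ∧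
      ∫ U, f' U ∂gibbsMeasure P β = β * ∫ U, f U * A' U ∂gibbsMeasure P β := by
  haveI : SecondCountableTopology (Matrix.specialUnitaryGroup (Fin N) ℂ) := by
    haveI := secondCountableTopology_matrix (n := Fin N)
    exact Topology.IsEmbedding.subtypeVal.secondCountableTopology
  have hre : ∀ g : Matrix.specialUnitaryGroup (Fin N) ℂ, reTr g = (fundamentalRep (Fin N) g).trace.re / N := fun g => by
    show UnitaryModel.nReTr (g : Matrix (Fin N) (Fin N) ℂ) = _
    simp [UnitaryModel.nReTr, Fintype.card_fin]
  exact gibbsMeasure_schwingerDyson_oneBond (fundamentalRep (Fin N)) (Literature.MathematicalPhysics.QuantumLattice.continuous_fundamentalRep (Fin N))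
    hre hβ b hk hkX f f' hfm hf'm hCf hCf' hf'

end SpecialUnitary

end Summit.QuantumFields.YangMills.Theorems.UnitScaleGibbsOneBondSchwingerDysonMatrix

end
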